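import Summits.PneNP.PneNP.Theorems.ChebyshevTracialDesignClosedPairCount
import HarnessLib

/-!
# Cell pnp-psdrank, route `ChebyshevTracialDesign`: the signed square sum over closed transversals of `k` dipoles
# (`ρ = 2^k Σ_{d even} C(k,d) · pm(k−d) · pm(d)² · pm(n−k−d)`)

Harmonic backbone of the `r = 1` rung of the crux `TracialDecayExp20` (stmt-PneNP-19878), matching side, brick (R1)
of prover g5's MEMO-7 ADDENDUM §B. Data: `k` dipoles `{a i, b i}` in `K_n` (`a, b : Fin k → Fin n` injective with
disjoint ranges). A SECTION `S ⊆ Fin k` picks `a i` for `i ∈ S` and `b i` otherwise; its TRANSVERSAL is the `k`-set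
`T_S = {a i : i ∈ S} ∪ {b i : i ∉ S}` (written `univ.image (fun i => if i ∈ S then a i else b i)` throughout; no
definitions). §1: two sections agree at a point iff they agree on that dipole, whence
`|T_S ∩ T_{S'}| = k − |S ∆ S'|`, `|T_S ∖ T_{S'}| = |T_{S'} ∖ T_S| = |S ∆ S'|`, `|(T_S ∪ T_{S'})ᶜ| = n − k − |S ∆ S'|`.
§2: with the block count of `…ClosedPairCount` (`card_filter_closed_closed`), the perfect matchings closed on both
`T_S` and `T_{S'}` number `pm(k−d) pm(d)² pm(n−k−d)`, `d = |S ∆ S'|`, and re-indexing `S' ↦ S ∆ S'` gives the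
SIGNED SQUARE SUM
`Σ_{M} (Σ_S (−1)^{|S|} [T_S is M-closed])² = 2^k Σ_{d ≤ k, d even} C(k,d) pm(k−d) pm(d)² pm(n−k−d)`
(`sum_sq_signed_closed_transversals`; odd `d` drop out because `pm` vanishes on odd sizes). §3: the interface with
the prover's matching-side functional `Π_p(M) = Σ_{T : #{x ∈ T : partner x ∈ T} = k} p_T`: for every coefficient
vector `p` supported on the transversals with `p(T_S) = c · (−1)^{|S|}` (lit's dipole product `dipoleVec k a b` is of
this form with `c = (−1)^k`), `Π_p(M) = c · Σ_S (−1)^{|S|} [T_S is M-closed]` and hence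
`Σ_M Π_p(M)² = c² · 2^k Σ_{d even} C(k,d) pm(k−d) pm(d)² pm(n−k−d)` (`sum_sq_transversalFunctional`). With the
prover's `kernelEigen_tight_even_mul` this is the closed form (★★) of the even eigenvalues of the tight Gram kernel.
[folklore] counting; background on the perfect-matching scheme [cite: GodsilMeagher2015, §15.2].
WHAT THIS IS NOT: not the eigenvalue assembly, not the monotonicity `λ_{2κ+2} ≤ λ_{2κ}`, nothing on psd rank;
instrument for the σ₂ step of the `r = 1` rung. Supports crux stmt-PneNP-19878.
-/

set_option linter.dupNamespace false -- `Summit.PneNP.PneNP.…`: summit = sub-problem (D-0017)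

namespace Summit.PneNP.PneNP.Theorems.ChebyshevTracialDesignTransversalSquareSum

open Finset Literature.Barriers.PneNP Literature.Combinatorics.SimpleGraph.CycleSpace
open Summit.PneNP.PneNP.Theorems.ChebyshevTracialDesignClosedPairCount
open scoped symmDiff

variable {n k : ℕ} {a b : Fin k → Fin n}

/-! ### §1 Sections and transversals of `k` dipoles -/

/-- Two sections agree at a point iff they pick the same dipole on the same side. [folklore] -/
theorem section_eq_iff (ha : Function.Injective a) (hb : Function.Injective b) (hab : ∀ i j, a i ≠ b j)
    (S S' : Finset (Fin k)) (i j : Fin k) :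
    (if i ∈ S then a i else b i) = (if j ∈ S' then a j else b j) ↔ i = j ∧ (i ∈ S ↔ i ∈ S') := by
  constructor
  · intro h
    by_cases hi : i ∈ S <;> by_cases hj : j ∈ S' <;> simp only [hi, hj, if_true, if_false] at h
    · obtain rfl := ha h
      exact ⟨rfl, iff_of_true hi hj⟩
    · exact (hab i j h).elim
    · exact (hab j i h.symm).elim
    · obtain rfl := hb h
      exact ⟨rfl, iff_of_false hi hj⟩
  · rintro ⟨rfl, h⟩
    by_cases hi : i ∈ S
    · rw [if_pos hi, if_pos (h.1 hi)]
    · rw [if_neg hi, if_neg fun h' => hi (h.2 h')]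

/-- A section is injective. [folklore] -/
theorem section_injective (ha : Function.Injective a) (hb : Function.Injective b) (hab : ∀ i j, a i ≠ b j)
    (S : Finset (Fin k)) : Function.Injective fun i => if i ∈ S then a i else b i :=
  fun i j h => ((section_eq_iff ha hb hab S S i j).1 h).1

/-- A transversal has `k` points. [folklore] -/
theorem card_transversal (ha : Function.Injective a) (hb : Function.Injective b) (hab : ∀ i j, a i ≠ b j)
    (S : Finset (Fin k)) : (univ.image fun i => if i ∈ S then a i else b i).card = k := by
  rw [card_image_of_injective _ (section_injective ha hb hab S), card_univ, Fintype.card_fin]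

/-- The dipoles on which two sections agree, and the symmetric difference, partition `Fin k`. [folklore] -/
theorem card_filter_iff_add_card_symmDiff (S S' : Finset (Fin k)) :
    (univ.filter fun i => (i ∈ S ↔ i ∈ S')).card + (S ∆ S').card = k := by
  classical
  have h : univ.filter (fun i => ¬ (i ∈ S ↔ i ∈ S')) = S ∆ S' := by
    ext i
    rw [mem_filter, mem_symmDiff]
    simp only [mem_univ, true_and]
    tauto
  rw [← h, card_filter_add_card_filter_not, card_univ, Fintype.card_fin]

/-- **Intersection of two transversals** = the common points of the two sections. [folklore] -/
theorem transversal_inter (ha : Function.Injective a) (hb : Function.Injective b) (hab : ∀ i j, a i ≠ b j)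
    (S S' : Finset (Fin k)) :
    (univ.image fun i => if i ∈ S then a i else b i) ∩ (univ.image fun i => if i ∈ S' then a i else b i) =
      (univ.filter fun i => (i ∈ S ↔ i ∈ S')).image fun i => if i ∈ S then a i else b i := by
  classical
  ext x
  simp only [mem_inter, mem_image, mem_filter, mem_univ, true_and]
  constructor
  · rintro ⟨⟨i, hi⟩, ⟨j, hj⟩⟩
    exact ⟨i, ((section_eq_iff ha hb hab S S' i j).1 (hi.trans hj.symm)).2, hi⟩
  · rintro ⟨i, hSS', hi⟩
    refine ⟨⟨i, hi⟩, ⟨i, ?_⟩⟩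
    rw [← hi]
    exact ((section_eq_iff ha hb hab S S' i i).2 ⟨rfl, hSS'⟩).symm

/-- `|T_S ∩ T_{S'}| + |S ∆ S'| = k`. [folklore] -/
theorem card_transversal_inter (ha : Function.Injective a) (hb : Function.Injective b) (hab : ∀ i j, a i ≠ b j)
    (S S' : Finset (Fin k)) :
    ((univ.image fun i => if i ∈ S then a i else b i) ∩ (univ.image fun i => if i ∈ S' then a i else b i)).card +
      (S ∆ S').card = k := by
  rw [transversal_inter ha hb hab, card_image_of_injective _ (section_injective ha hb hab S),
    card_filter_iff_add_card_symmDiff]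

/-- **Difference of two transversals** = the points of the first section over the dipoles where they differ.
[folklore] -/
theorem transversal_sdiff (ha : Function.Injective a) (hb : Function.Injective b) (hab : ∀ i j, a i ≠ b j)
    (S S' : Finset (Fin k)) :
    (univ.image fun i => if i ∈ S then a i else b i) \ (univ.image fun i => if i ∈ S' then a i else b i) =
      (S ∆ S').image fun i => if i ∈ S then a i else b i := by
  classical
  ext x
  simp only [mem_sdiff, mem_image, mem_univ, true_and, not_exists, mem_symmDiff]
  constructor
  · rintro ⟨⟨i, hi⟩, hno⟩
    refine ⟨i, ?_, hi⟩
    by_contra hcon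
    have hiff : i ∈ S ↔ i ∈ S' := by tauto
    apply hno i
    rw [← hi]
    exact ((section_eq_iff ha hb hab S S' i i).2 ⟨rfl, hiff⟩).symm
  · rintro ⟨i, hd, hi⟩
    refine ⟨⟨i, hi⟩, fun j hj => ?_⟩
    have := (section_eq_iff ha hb hab S' S j i).1 (hj.trans hi.symm)
    obtain ⟨rfl, hiff⟩ := this
    tauto

/-- `|T_S ∖ T_{S'}| = |S ∆ S'|`. [folklore] -/
theorem card_transversal_sdiff (ha : Function.Injective a) (hb : Function.Injective b) (hab : ∀ i j, a i ≠ b j)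
    (S S' : Finset (Fin k)) :
    ((univ.image fun i => if i ∈ S then a i else b i) \ (univ.image fun i => if i ∈ S' then a i else b i)).card =
      (S ∆ S').card := by
  rw [transversal_sdiff ha hb hab, card_image_of_injective _ (section_injective ha hb hab S)]

/-- `|(T_S ∪ T_{S'})ᶜ| = n − k − |S ∆ S'|`. [folklore] -/
theorem card_transversal_union_compl (ha : Function.Injective a) (hb : Function.Injective b)
    (hab : ∀ i j, a i ≠ b j) (S S' : Finset (Fin k)) :
    ((univ.image fun i => if i ∈ S then a i else b i) ∪ (univ.image fun i => if i ∈ S' then a i else b i))ᶜ.card =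
      n - k - (S ∆ S').card := by
  rw [card_compl, Fintype.card_fin, union_comm, ← card_sdiff_add_card, card_transversal_sdiff ha hb hab,
    card_transversal ha hb hab, symmDiff_comm]
  omega

/-- Distinct sections have distinct transversals. [folklore] -/
theorem transversal_injective (ha : Function.Injective a) (hb : Function.Injective b) (hab : ∀ i j, a i ≠ b j) :
    Function.Injective fun S : Finset (Fin k) => univ.image fun i => if i ∈ S then a i else b i := by
  intro S S' h
  have hk := card_transversal_inter ha hb hab S S'
  simp only at h
  rw [h, inter_self, card_transversal ha hb hab S'] at hk
  have h0 : (S ∆ S').card = 0 := by omega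
  rw [card_eq_zero, ← bot_eq_empty, symmDiff_eq_bot] at h0
  exact h0

/-! ### §2 Perfect matchings closed on two transversals, and the signed square sum -/

/-- **Closed pairs of transversals.** The perfect matchings of `K_n` closed on both `T_S` and `T_{S'}` number
`pm(k − d) · pm(d) · pm(d) · pm(n − k − d)` with `d = |S ∆ S'|`. [folklore] -/
theorem card_filter_closed_transversals (ha : Function.Injective a) (hb : Function.Injective b)
    (hab : ∀ i j, a i ≠ b j) (S S' : Finset (Fin k)) :
    (univ.filter fun M : PMatch n =>
        (∀ x ∈ univ.image (fun i => if i ∈ S then a i else b i),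
            M.2.partner x ∈ univ.image (fun i => if i ∈ S then a i else b i)) ∧
          ∀ x ∈ univ.image (fun i => if i ∈ S' then a i else b i),
            M.2.partner x ∈ univ.image (fun i => if i ∈ S' then a i else b i)).card =
      pmCount (k - (S ∆ S').card) * pmCount (S ∆ S').card * pmCount (S ∆ S').card *
        pmCount (n - k - (S ∆ S').card) := by
  have hk := card_transversal_inter ha hb hab S S'
  have hi : ((univ.image fun i => if i ∈ S then a i else b i) ∩
      (univ.image fun i => if i ∈ S' then a i else b i)).card = k - (S ∆ S').card := by omega
  rw [card_filter_closed_closed, hi, card_transversal_sdiff ha hb hab S S', card_transversal_sdiff ha hb hab S' S,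
    symmDiff_comm S' S, card_transversal_union_compl ha hb hab S S']

/-- Sign bookkeeping: `(−1)^{|S| + |S'|} = (−1)^{|S ∆ S'|}`. [folklore] -/
theorem neg_one_pow_card_add_card (S S' : Finset (Fin k)) :
    (-1 : ℝ) ^ (S.card + S'.card) = (-1) ^ (S ∆ S').card := by
  have h1 := card_union_add_card_inter S S'
  have h2 : (S ∆ S').card + (S ∩ S').card = (S ∪ S').card := by
    rw [symmDiff_eq_sup_sdiff_inf, sup_eq_union, inf_eq_inter, card_sdiff_add_card_eq_card inter_subset_union]
  rw [show S.card + S'.card = (S ∆ S').card + 2 * (S ∩ S').card by omega, pow_add, pow_mul]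
  norm_num

/-- Re-indexing a sum over all sections by `S' ↦ S ∆ S'`. [folklore] -/
theorem sum_symmDiff_comp (S : Finset (Fin k)) (G : Finset (Fin k) → ℝ) :
    ∑ S' : Finset (Fin k), G (S ∆ S') = ∑ D : Finset (Fin k), G D :=
  Fintype.sum_bijective (fun S' => S ∆ S')
    (Function.Involutive.bijective fun S' => symmDiff_symmDiff_cancel_left S S') _ _ fun _ => rfl

/-- Summing a function of the cardinality over all subsets of `Fin k`. [folklore] -/
theorem sum_univ_finset_card (G : ℕ → ℝ) :
    ∑ D : Finset (Fin k), G D.card = ∑ d ∈ range (k + 1), (k.choose d : ℝ) * G d := by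
  rw [← powerset_univ, sum_powerset_apply_card]
  simp only [card_univ, Fintype.card_fin, nsmul_eq_mul]

/-- **The signed square sum over closed transversals.** For `k` dipoles `{a i, b i}` of `K_n`,
`Σ_{M} (Σ_S (−1)^{|S|} · [T_S is M-closed])² = 2^k · Σ_{d ≤ k, d even} C(k,d) · pm(k−d) · pm(d)² · pm(n−k−d)`.
[folklore] -/
theorem sum_sq_signed_closed_transversals (ha : Function.Injective a) (hb : Function.Injective b)
    (hab : ∀ i j, a i ≠ b j) :
    ∑ M : PMatch n, (∑ S : Finset (Fin k), (-1 : ℝ) ^ S.card *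
        (if ∀ x ∈ univ.image (fun i => if i ∈ S then a i else b i),
              M.2.partner x ∈ univ.image (fun i => if i ∈ S then a i else b i) then 1 else 0)) ^ 2 =
      2 ^ k * ∑ d ∈ range (k + 1),
        if Even d then (k.choose d : ℝ) * pmCount (k - d) * pmCount d ^ 2 * pmCount (n - k - d) else 0 := by
  classical
  -- name the transversals `T S` and the block product `F d`
  obtain ⟨T, hT⟩ : ∃ T : Finset (Fin k) → Finset (Fin n),
      ∀ S, T S = univ.image (fun i => if i ∈ S then a i else b i) := ⟨_, fun _ => rfl⟩
  simp only [← hT]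
  obtain ⟨F, hF⟩ : ∃ F : ℕ → ℝ, ∀ d, F d = pmCount (k - d) * pmCount d ^ 2 * pmCount (n - k - d) :=
    ⟨_, fun _ => rfl⟩
  -- the sum over matchings of one product of two signed indicators
  have hpair : ∀ S S' : Finset (Fin k),
      ∑ M : PMatch n, ((-1 : ℝ) ^ S.card * (if (∀ x ∈ T S, M.2.partner x ∈ T S) then 1 else 0)) *
        ((-1 : ℝ) ^ S'.card * (if (∀ x ∈ T S', M.2.partner x ∈ T S') then 1 else 0)) =
      (-1 : ℝ) ^ (S ∆ S').card * F (S ∆ S').card := by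
    intro S S'
    have hrw : ∀ M : PMatch n,
        ((-1 : ℝ) ^ S.card * (if (∀ x ∈ T S, M.2.partner x ∈ T S) then (1 : ℝ) else 0)) *
          ((-1 : ℝ) ^ S'.card * (if (∀ x ∈ T S', M.2.partner x ∈ T S') then 1 else 0)) =
        (-1 : ℝ) ^ (S.card + S'.card) *
          (if ((∀ x ∈ T S, M.2.partner x ∈ T S) ∧ ∀ x ∈ T S', M.2.partner x ∈ T S') then 1 else 0) := by
      intro M
      rw [pow_add]
      by_cases h1 : ∀ x ∈ T S, M.2.partner x ∈ T S <;>
        by_cases h2 : ∀ x ∈ T S', M.2.partner x ∈ T S'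
      · rw [if_pos h1, if_pos h2, if_pos ⟨h1, h2⟩]; ring
      · rw [if_pos h1, if_neg h2, if_neg fun h => h2 h.2]; ring
      · rw [if_neg h1, if_pos h2, if_neg fun h => h1 h.1]; ring
      · rw [if_neg h1, if_neg h2, if_neg fun h => h1 h.1]; ring
    rw [sum_congr rfl fun M _ => hrw M, ← mul_sum, sum_boole, neg_one_pow_card_add_card]
    congr 1
    have hc := card_filter_closed_transversals (n := n) ha hb hab S S'
    simp only [← hT] at hc
    have hc' := congrArg (Nat.cast (R := ℝ)) hc
    push_cast at hc'
    rw [hF, hc']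
    ring
  calc ∑ M : PMatch n, (∑ S, (-1 : ℝ) ^ S.card * (if (∀ x ∈ T S, M.2.partner x ∈ T S) then 1 else 0)) ^ 2
      = ∑ M : PMatch n, ∑ S, ∑ S', ((-1 : ℝ) ^ S.card * (if (∀ x ∈ T S, M.2.partner x ∈ T S) then 1 else 0)) *
          ((-1 : ℝ) ^ S'.card * (if (∀ x ∈ T S', M.2.partner x ∈ T S') then 1 else 0)) := by
        refine sum_congr rfl fun M _ => ?_
        rw [sq, sum_mul_sum]
    _ = ∑ S, ∑ S', ∑ M : PMatch n, ((-1 : ℝ) ^ S.card * (if (∀ x ∈ T S, M.2.partner x ∈ T S) then 1 else 0)) *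
          ((-1 : ℝ) ^ S'.card * (if (∀ x ∈ T S', M.2.partner x ∈ T S') then 1 else 0)) := by
        rw [sum_comm]
        refine sum_congr rfl fun S _ => ?_
        rw [sum_comm]
    _ = ∑ S : Finset (Fin k), ∑ S' : Finset (Fin k), (-1 : ℝ) ^ (S ∆ S').card * F (S ∆ S').card :=
        sum_congr rfl fun S _ => sum_congr rfl fun S' _ => hpair S S'
    _ = ∑ S : Finset (Fin k), ∑ D : Finset (Fin k), (-1 : ℝ) ^ D.card * F D.card :=
        sum_congr rfl fun S _ => sum_symmDiff_comp S (fun D => (-1 : ℝ) ^ D.card * F D.card)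
    _ = 2 ^ k * ∑ D : Finset (Fin k), (-1 : ℝ) ^ D.card * F D.card := by
        rw [sum_const, card_univ, Fintype.card_finset, Fintype.card_fin, nsmul_eq_mul]
        push_cast
        ring
    _ = 2 ^ k * ∑ d ∈ range (k + 1), (k.choose d : ℝ) * ((-1 : ℝ) ^ d * F d) := by
        rw [sum_univ_finset_card (fun d => (-1 : ℝ) ^ d * F d)]
    _ = 2 ^ k * ∑ d ∈ range (k + 1),
        if Even d then (k.choose d : ℝ) * pmCount (k - d) * pmCount d ^ 2 * pmCount (n - k - d) else 0 := by
        congr 1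
        refine sum_congr rfl fun d _ => ?_
        rcases Nat.even_or_odd d with hd | hd
        · rw [if_pos hd, hd.neg_one_pow, one_mul, hF]
          ring
        · rw [if_neg (Nat.not_even_iff_odd.2 hd), hF, pmCount_of_odd hd]
          simp

/-! ### §3 Interface with the matching-side functional `Π_p(M) = Σ_{T : #{x ∈ T : partner x ∈ T} = k} p_T` -/

/-- **A coefficient vector supported on the transversals, with values `c · (−1)^{|S|}`, has matching-side
functional `Π_p(M) = c · Σ_S (−1)^{|S|} [T_S is M-closed]`** (the prover's `Π_p` sums `p` over the sets with exactly
`k` points matched inside; off the transversals `p` vanishes, and a transversal has `k` points matched inside iff it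
is `M`-closed). [folklore] -/
theorem transversalFunctional_eq (ha : Function.Injective a) (hb : Function.Injective b) (hab : ∀ i j, a i ≠ b j)
    (M : PMatch n) (p : Finset (Fin n) → ℝ) (c : ℝ)
    (hp : ∀ S : Finset (Fin k), p (univ.image fun i => if i ∈ S then a i else b i) = c * (-1) ^ S.card)
    (hp0 : ∀ T : Finset (Fin n),
      (∀ S : Finset (Fin k), T ≠ univ.image fun i => if i ∈ S then a i else b i) → p T = 0) :
    ∑ T ∈ univ.filter (fun T : Finset (Fin n) => (T.filter fun x => M.2.partner x ∈ T).card = k), p T =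
      c * ∑ S : Finset (Fin k), (-1 : ℝ) ^ S.card *
        (if ∀ x ∈ univ.image (fun i => if i ∈ S then a i else b i),
              M.2.partner x ∈ univ.image (fun i => if i ∈ S then a i else b i) then 1 else 0) := by
  classical
  have hTinj := transversal_injective ha hb hab
  have hcardT := card_transversal ha hb hab (n := n)
  obtain ⟨T, hT⟩ : ∃ T : Finset (Fin k) → Finset (Fin n),
      ∀ S, T S = univ.image (fun i => if i ∈ S then a i else b i) := ⟨_, fun _ => rfl⟩
  simp only [← hT] at hp hp0 hTinj hcardT ⊢
  have hsub : (univ.image T).filter (fun T' : Finset (Fin n) => (T'.filter fun x => M.2.partner x ∈ T').card = k) ⊆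
      univ.filter (fun T' : Finset (Fin n) => (T'.filter fun x => M.2.partner x ∈ T').card = k) :=
    filter_subset_filter _ (subset_univ _)
  rw [← sum_subset hsub ?_]
  · rw [sum_filter, sum_image fun S _ S' _ h => hTinj h, mul_sum]
    refine sum_congr rfl fun S _ => ?_
    have hclosed : ((T S).filter fun x => M.2.partner x ∈ T S).card = k ↔ ∀ x ∈ T S, M.2.partner x ∈ T S := by
      constructor
      · intro h
        exact (closed_iff_card_filter_eq M (T S)).2 (h.trans (hcardT S).symm)
      · intro h
        exact ((closed_iff_card_filter_eq M (T S)).1 h).trans (hcardT S)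
    by_cases h : ∀ x ∈ T S, M.2.partner x ∈ T S
    · rw [if_pos (hclosed.2 h), if_pos h, hp, mul_one]
    · rw [if_neg (fun h' => h (hclosed.1 h')), if_neg h, mul_zero, mul_zero]
  · intro T' hT' hT'not
    apply hp0
    intro S hS
    apply hT'not
    rw [mem_filter] at hT' ⊢
    exact ⟨mem_image.2 ⟨S, mem_univ _, hS.symm⟩, hT'.2⟩

/-- **Square sum of the matching-side functional of a signed transversal vector** (e.g. of the dipole product
`χ = Π_i (x_{a i} − x_{b i})`, whose coefficients are `(−1)^{#b}` on the transversals: `c = (−1)^k`):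
`Σ_M Π_p(M)² = c² · 2^k · Σ_{d ≤ k, d even} C(k,d) · pm(k−d) · pm(d)² · pm(n−k−d)`. [folklore] -/
theorem sum_sq_transversalFunctional (ha : Function.Injective a) (hb : Function.Injective b) (hab : ∀ i j, a i ≠ b j)
    (p : Finset (Fin n) → ℝ) (c : ℝ)
    (hp : ∀ S : Finset (Fin k), p (univ.image fun i => if i ∈ S then a i else b i) = c * (-1) ^ S.card)
    (hp0 : ∀ T : Finset (Fin n),
      (∀ S : Finset (Fin k), T ≠ univ.image fun i => if i ∈ S then a i else b i) → p T = 0) :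
    ∑ M : PMatch n,
        (∑ T ∈ univ.filter (fun T : Finset (Fin n) => (T.filter fun x => M.2.partner x ∈ T).card = k), p T) ^ 2 =
      c ^ 2 * (2 ^ k * ∑ d ∈ range (k + 1),
        if Even d then (k.choose d : ℝ) * pmCount (k - d) * pmCount d ^ 2 * pmCount (n - k - d) else 0) := by
  rw [← sum_sq_signed_closed_transversals ha hb hab, mul_sum]
  refine sum_congr rfl fun M _ => ?_
  rw [transversalFunctional_eq ha hb hab M p c hp hp0, mul_pow]

end Summit.PneNP.PneNP.Theorems.ChebyshevTracialDesignTransversalSquareSum
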